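import Literature.Probability.RandomPlanarGeometry.SkorokhodStep
import Literature.Probability.RandomPlanarGeometry.SkorokhodFiniteMartingale
import HarnessLib

/-!
# Skorokhod embedding: the uniform randomiser, the label bookkeeping, and the stage invariant

Topic `Probability/RandomPlanarGeometry`, sub-namespace `SkorokhodEmbedding` (support file for
Lawler–Schramm–Werner (2004), Lemma 3.8 / Durrett (2019), Thm. 8.2.1). Everything here is PROVED;
no named fact is introduced.

The embedding of a martingale on a finite probability space (`MartingaleData`, file
`SkorokhodFiniteMartingale`) into Brownian motion is built by induction on the number of steps,
each step enlarging the probability space by an independent uniform randomiser (Durrett (2019),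
proof of Thm. 8.2.1, with the randomised two-point embedding of Thm. 8.1.1). This file provides:

* the **uniform law** `unif` on `[0, 1)` and the law of the weighted selection under it
  (`unif_wselect_eq`, from `SkorokhodSelection`), plus positivity of the selected weight;
* the **label bookkeeping** of a step: the finite label sets `labelSet`, the level map `levels`
  (levels of the selected pair) and the next label `nextLabel`, with their measurability (labels
  live in a countable type with measurable singletons) and the width bound `hi - lo ≤ 4δ`;
* **pull-back lemmas** along the first projection of `Q.prod unif`;
* the **stage invariant** `Stage D n`: a probability space carrying the Brownian path `W`, the
  label chain `lam k`, the embedding times `τ k` (`k ≤ n`) and a filtration `G`, with the laws of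
  the labels, the embedding identity `W(τ k) = Mval k (lam k)` a.s., the oscillation bound on
  `[τ k, τ (k+1)]`, the martingale-difference identities of `τ (k+1) - τ k - (ΔW)²` in
  test-function form, the bound `E[(Δτ)² ; A] ≤ C₄ (4δ)⁴ Q(A)`, and the strong Markov
  continuation (`the post-τ n path is a Brownian path independent of G n`);
* the **initial stage** `stageZero` (sample the initial label, `τ 0 = 0`).

The induction step and the embedding theorem are in `SkorokhodEmbedding`.

## References

* R. Durrett, *Probability: Theory and Examples*, 5th ed. (2019), Thms. 8.1.1, 8.2.1.
* G. F. Lawler, O. Schramm, W. Werner, Ann. Probab. 32 (2004), Lemma 3.8.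
-/

noncomputable section

open MeasureTheory ProbabilityTheory Filter Set
open scoped NNReal ENNReal Topology

namespace Literature.Probability.RandomPlanarGeometry.SkorokhodEmbedding

open Literature.Probability.Process Literature.Probability.RandomPlanarGeometry

/-! ### The uniform randomiser -/

/-- The **uniform law on `[0, 1)`** (Lebesgue measure restricted). [folklore] -/
def unif : Measure ℝ := volume.restrict (Set.Ico (0 : ℝ) 1)

/-- The uniform law is a probability measure. [folklore] -/
instance isProbabilityMeasure_unif : IsProbabilityMeasure unif :=
  ⟨by rw [unif, Measure.restrict_apply MeasurableSet.univ, univ_inter, Real.volume_Ico]; simp⟩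

/-- The uniform law of a measurable set is the Lebesgue measure of its trace on `[0, 1)`.
[folklore] -/
theorem unif_apply {S : Set ℝ} (hS : MeasurableSet S) : unif S = volume (Set.Ico (0 : ℝ) 1 ∩ S) := by
  rw [unif, Measure.restrict_apply hS, inter_comm]

/-- Uniform-almost every point lies in `[0, 1)`. [folklore] -/
theorem ae_mem_Ico_unif : ∀ᵐ u ∂unif, u ∈ Set.Ico (0 : ℝ) 1 :=
  ae_restrict_mem measurableSet_Ico

section Selection

variable {σ : Type*} [MeasurableSpace σ] [MeasurableSingletonClass σ]

/-- **The law of the weighted selection under the uniform randomiser**: `unif{wselect = x} = wt x`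
(`wt ≥ 0` on `s`, `∑_s wt = 1`, `x ∈ s`). Durrett (2019), proof of Thm. 8.1.1.
[cite: Durrett2019, Thm. 8.1.1] -/
theorem unif_wselect_eq {s : Finset σ} {wt : σ → ℝ} (hw : ∀ x ∈ s, 0 ≤ wt x)
    (hsum : ∑ x ∈ s, wt x = 1) (d : σ) {x : σ} (hx : x ∈ s) :
    unif {u | wselect s wt d u = x} = ENNReal.ofReal (wt x) := by
  rw [unif_apply (S := {u | wselect s wt d u = x}) (measurable_wselect s wt d (measurableSet_singleton x))]
  exact volume_Ico_inter_wselect hw hsum d hx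

/-- Real-valued form of `unif_wselect_eq`. [folklore] -/
theorem unif_real_wselect_eq {s : Finset σ} {wt : σ → ℝ} (hw : ∀ x ∈ s, 0 ≤ wt x)
    (hsum : ∑ x ∈ s, wt x = 1) (d : σ) {x : σ} (hx : x ∈ s) :
    unif.real {u | wselect s wt d u = x} = wt x := by
  rw [measureReal_def, unif_wselect_eq hw hsum d hx, ENNReal.toReal_ofReal (hw x hx)]

/-- Outside the set the selection has probability zero (when the weights sum to one).
[folklore] -/
theorem unif_wselect_eq_zero {s : Finset σ} {wt : σ → ℝ} (hw : ∀ x ∈ s, 0 ≤ wt x)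
    (hsum : ∑ x ∈ s, wt x = 1) (d : σ) {x : σ} (hx : x ∉ s) :
    unif {u | wselect s wt d u = x} = 0 := by
  have hs : s.Nonempty := by
    by_contra h
    rw [Finset.not_nonempty_iff_eq_empty] at h
    rw [h, Finset.sum_empty] at hsum
    exact zero_ne_one hsum
  -- the events `{wselect = y}`, `y ∈ s`, already have total mass one
  have htot : unif (⋃ y ∈ s, {u | wselect s wt d u = y}) = 1 := by
    rw [measure_biUnion_finset]
    · rw [Finset.sum_congr rfl fun y hy ↦ unif_wselect_eq hw hsum d hy,
        ← ENNReal.ofReal_sum_of_nonneg hw, hsum, ENNReal.ofReal_one]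
    · intro y _ y' _ hyy'
      exact Set.disjoint_left.2 fun u (hu : _ = y) (hu' : _ = y') ↦ hyy' (hu.symm.trans hu')
    · exact fun y _ ↦ measurable_wselect s wt d (measurableSet_singleton y)
  have hdisj : Disjoint (⋃ y ∈ s, {u | wselect s wt d u = y}) {u | wselect s wt d u = x} := by
    rw [Set.disjoint_left]
    simp only [mem_iUnion, mem_setOf_eq, exists_prop]
    rintro u ⟨y, hy, rfl⟩ h
    exact hx (h ▸ hy)
  have hle := measure_mono (μ := unif) (subset_univ ((⋃ y ∈ s, {u | wselect s wt d u = y}) ∪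
    {u | wselect s wt d u = x}))
  rw [measure_union hdisj (measurable_wselect s wt d (measurableSet_singleton x)), htot,
    measure_univ] at hle
  by_contra hne
  exact absurd hle (not_le.2 (by
    calc (1 : ℝ≥0∞) = 1 + 0 := (add_zero 1).symm
      _ < 1 + unif {u | wselect s wt d u = x} :=
        ENNReal.add_lt_add_left ENNReal.one_ne_top (pos_iff_ne_zero.2 hne)))

omit [MeasurableSpace σ] [MeasurableSingletonClass σ] in
/-- **The selected element has positive weight** for `u ∈ [0, 1)` (`wt ≥ 0`, `∑_s wt = 1`).
[folklore] -/
theorem wt_wselect_pos {s : Finset σ} {wt : σ → ℝ} (hw : ∀ x ∈ s, 0 ≤ wt x)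
    (hsum : ∑ x ∈ s, wt x = 1) (d : σ) {u : ℝ} (hu : u ∈ Set.Ico (0 : ℝ) 1) :
    0 < wt (wselect s wt d u) := by
  have hs : s.Nonempty := by
    by_contra h
    rw [Finset.not_nonempty_iff_eq_empty] at h
    rw [h, Finset.sum_empty] at hsum
    exact zero_ne_one hsum
  haveI : NeZero s.card := ⟨(Finset.card_pos.2 hs).ne'⟩
  set e := s.equivFin with he
  set w : Fin s.card → ℝ := fun i ↦ wt (e.symm i) with hwdef
  have hw' : ∀ i, 0 ≤ w i := fun i ↦ hw _ (Subtype.coe_prop _)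
  have hsum' : ∑ i, w i = 1 := by
    rw [← hsum, hwdef, ← Finset.sum_coe_sort s wt]
    exact e.symm.sum_comp (fun y : s ↦ wt y)
  set k := finSelect w u with hk
  have hsel : wselect s wt d u = e.symm k := by
    rw [wselect, dif_pos hs]
  have hmem : u ∈ Set.Ico (0 : ℝ) 1 ∩ {u | finSelect w u = k} := ⟨hu, rfl⟩
  rw [Ico_inter_finSelect_eq hw' hsum' k] at hmem
  have : 0 < w k := by
    have h := hmem.2
    rw [cumSum_eq_cumSumLT_add] at h
    linarith [hmem.1]
  rwa [hsel]

end Selection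

/-! ### Label bookkeeping of a step -/

namespace MartingaleData

variable {Ω Λ : Type*} [Fintype Ω] [MeasurableSpace Ω] [DecidableEq Λ] (D : MartingaleData Ω Λ)

/-- The finite set of all labels up to level `n` (values of `H j`, `j ≤ n`). [folklore] -/
def labelSet (n : ℕ) : Finset Λ := (Finset.range (n + 1)).biUnion fun j ↦ Finset.univ.image (D.H j)

/-- A default label. [folklore] -/
def defaultLabel [Nonempty Ω] : Λ := D.H 0 (Classical.arbitrary Ω)

/-- Projection of a label to the finite label set (identity there, the default label
elsewhere) — makes the level map of a step take finitely many values on junk inputs too.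
[folklore] -/
def projLabel [Nonempty Ω] (n : ℕ) (l : Λ) : Λ := if l ∈ D.labelSet n then l else D.defaultLabel

/-- Values of `H j`, `j ≤ n`, are labels up to level `n`. [folklore] -/
theorem H_mem_labelSet {j n : ℕ} (hj : j ≤ n) (ω : Ω) : D.H j ω ∈ D.labelSet n := by
  simp only [labelSet, Finset.mem_biUnion, Finset.mem_range, Finset.mem_image, Finset.mem_univ,
    true_and]
  exact ⟨j, Nat.lt_succ_of_le hj, ω, rfl⟩

/-- The label sets increase. [folklore] -/
theorem labelSet_mono {m n : ℕ} (h : m ≤ n) : D.labelSet m ⊆ D.labelSet n := by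
  intro l hl
  simp only [labelSet, Finset.mem_biUnion, Finset.mem_range] at hl ⊢
  obtain ⟨j, hj, hl⟩ := hl
  exact ⟨j, by omega, hl⟩

/-- Children are labels of the next level. [folklore] -/
theorem children_subset_labelSet (n : ℕ) (l : Λ) : D.children n l ⊆ D.labelSet (n + 1) := by
  intro c hc
  obtain ⟨ω, -, rfl⟩ := Finset.mem_image.1 hc
  exact D.H_mem_labelSet le_rfl ω

/-- The projection lands in the label set. [folklore] -/
theorem projLabel_mem [Nonempty Ω] (n : ℕ) (l : Λ) : D.projLabel n l ∈ D.labelSet n := by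
  unfold projLabel
  split_ifs with h
  · exact h
  · exact D.H_mem_labelSet (Nat.zero_le n) _

/-- The projection is the identity on the label set. [folklore] -/
theorem projLabel_of_mem [Nonempty Ω] {n : ℕ} {l : Λ} (h : l ∈ D.labelSet n) :
    D.projLabel n l = l := by
  rw [projLabel, if_pos h]

/-- **The level map of a step**: the levels `(x i, x j)` of the pair selected by `u` at the atom
`{H n = l}`. Durrett (2019), proof of Thm. 8.1.1 (`(U, V)`). [folklore] -/
def levels (n : ℕ) (l : Λ) (u : ℝ) : ℝ × ℝ :=
  (D.lo n l (D.selPair n l u), D.hi n l (D.selPair n l u))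

/-- **The next label of a step**: the child produced by the selected pair and the exit value.
[folklore] -/
def nextLabel (n : ℕ) (l : Λ) (u v : ℝ) : Λ := D.childOf n l (D.selPair n l u) v

/-- The selected pair is a pair of children or the junk pair `(l, l)`. [folklore] -/
theorem selPair_mem_or (n : ℕ) (l : Λ) (u : ℝ) :
    D.selPair n l u ∈ D.stepPairs n l ∨ D.selPair n l u = (l, l) := by
  unfold MartingaleData.selPair wselect
  split_ifs with h
  · exact Or.inl (Subtype.coe_prop _)
  · exact Or.inr rfl

variable {D}

/-- **Width of the selected interval**: `hi - lo ≤ 4δ` for every input (`δ ≥ 0`; children have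
`|x| ≤ 2δ`, the junk pair has `lo = hi`). [folklore] -/
theorem levels_width_le (hD : D.IsValid) (hδ : 0 ≤ D.δ) (n : ℕ) (l : Λ) (u : ℝ) :
    (D.levels n l u).2 - (D.levels n l u).1 ≤ 4 * D.δ := by
  rcases D.selPair_mem_or n l u with h | h
  · simp only [levels, MartingaleData.lo, MartingaleData.hi]
    obtain ⟨h1, h2⟩ := Finset.mem_product.1 h
    have hb1 := abs_le.1 (MartingaleData.abs_xc_le hD hδ n l _ h1)
    have hb2 := abs_le.1 (MartingaleData.abs_xc_le hD hδ n l _ h2)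
    linarith [hb1.1, hb2.2]
  · simp only [levels, MartingaleData.lo, MartingaleData.hi, h, sub_self]
    linarith

/-- The levels of a pair of positive weight lie in `[-2δ, 2δ]` and straddle `0`. [folklore] -/
theorem levels_of_weight_pos (hD : D.IsValid) (hδ : 0 ≤ D.δ) {n : ℕ} {l : Λ} {u : ℝ}
    (h : D.stepWeight n l (D.selPair n l u) ≠ 0) :
    |(D.levels n l u).1| ≤ 2 * D.δ ∧ |(D.levels n l u).2| ≤ 2 * D.δ ∧
      (D.levels n l u).1 ≤ 0 ∧ 0 ≤ (D.levels n l u).2 := by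
  obtain ⟨hb1, hb2⟩ := MartingaleData.abs_levels_le hD hδ h
  obtain ⟨-, hcase⟩ := MartingaleData.levels_of_stepWeight_ne_zero h
  refine ⟨hb1, hb2, ?_⟩
  rcases hcase with h' | ⟨-, h1, h2⟩
  · exact ⟨h'.1.le, h'.2.le⟩
  · exact ⟨h1.le, h2.ge⟩

/-- The next label lies in the next label set whenever the current label lies in the current
one. [folklore] -/
theorem nextLabel_mem_labelSet {n : ℕ} {l : Λ} (hl : l ∈ D.labelSet n) (u v : ℝ) :
    D.nextLabel n l u v ∈ D.labelSet (n + 1) := by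
  unfold nextLabel MartingaleData.childOf
  rcases D.selPair_mem_or n l u with h | h
  · obtain ⟨h1, h2⟩ := Finset.mem_product.1 h
    split_ifs
    · exact D.children_subset_labelSet n l h1
    · exact D.children_subset_labelSet n l h2
  · rw [h]
    split_ifs <;> exact D.labelSet_mono (Nat.le_succ n) hl

variable (D)

/-- The selected pair is a measurable function of the randomiser. [folklore] -/
theorem measurable_selPair [MeasurableSpace Λ] (n : ℕ) (l : Λ) : Measurable (D.selPair n l) :=
  measurable_wselect _ _ _

variable [Countable Λ] [MeasurableSpace Λ] [MeasurableSingletonClass Λ]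

/-- The level map is measurable in the randomiser. [folklore] -/
theorem measurable_levels (n : ℕ) (l : Λ) : Measurable (D.levels n l) :=
  (measurable_of_countable fun ij : Λ × Λ ↦ (D.lo n l ij, D.hi n l ij)).comp (D.measurable_selPair n l)

/-- The level map is jointly measurable in (randomiser, label). [folklore] -/
theorem measurable_levels_uncurry (n : ℕ) : Measurable fun x : ℝ × Λ ↦ D.levels n x.2 x.1 :=
  measurable_from_prod_countable_left fun l ↦ D.measurable_levels n l

/-- The next label is jointly measurable in (randomiser, exit value, label). [folklore] -/
theorem measurable_nextLabel (n : ℕ) :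
    Measurable fun x : (ℝ × ℝ) × Λ ↦ D.nextLabel n x.2 x.1.1 x.1.2 := by
  refine measurable_from_prod_countable_left fun l ↦ ?_
  change Measurable fun x : ℝ × ℝ ↦ D.childOf n l (D.selPair n l x.1) x.2
  unfold MartingaleData.childOf
  refine Measurable.ite ?_ ?_ ?_
  · exact measurableSet_eq_fun measurable_snd
      ((measurable_of_countable fun ij : Λ × Λ ↦ D.lo n l ij).comp
        ((D.measurable_selPair n l).comp measurable_fst))
  · exact (measurable_of_countable fun ij : Λ × Λ ↦ ij.1).comp
      ((D.measurable_selPair n l).comp measurable_fst)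
  · exact (measurable_of_countable fun ij : Λ × Λ ↦ ij.2).comp
      ((D.measurable_selPair n l).comp measurable_fst)

omit [Countable Λ] [MeasurableSpace Λ] [MeasurableSingletonClass Λ] in
/-- The level map has finite range on inputs with labels in the label set (through
`projLabel`): finitely many labels, each with finitely many pairs. [folklore] -/
theorem finite_range_levels_projLabel [Nonempty Ω] (n : ℕ) :
    (Set.range fun x : ℝ × Λ ↦ D.levels n (D.projLabel n x.2) x.1).Finite := by
  classical
  refine (((D.labelSet n).biUnion fun l ↦ insert ((D.lo n l (l, l), D.hi n l (l, l)))
    ((D.stepPairs n l).image fun ij ↦ (D.lo n l ij, D.hi n l ij))).finite_toSet).subset ?_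
  rintro _ ⟨⟨u, l⟩, rfl⟩
  simp only [Finset.coe_biUnion, Finset.mem_coe, Set.mem_iUnion, Finset.mem_insert, Finset.mem_image,
    exists_prop]
  refine ⟨D.projLabel n l, D.projLabel_mem n l, ?_⟩
  rcases D.selPair_mem_or n (D.projLabel n l) u with h | h
  · exact Or.inr ⟨_, h, rfl⟩
  · left
    simp only [levels, h]

end MartingaleData

/-! ### Pull-back along the first projection of `Q.prod unif` -/

section Comap

variable {Ω' : Type*}

/-- A function measurable for a σ-algebra `m` on `Ω'` is, composed with the first projection,
measurable for the pulled-back σ-algebra `m.comap Prod.fst`. [folklore] -/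
theorem measurable_comp_fst_comap {β : Type*} [MeasurableSpace β] {m : MeasurableSpace Ω'}
    {f : Ω' → β} (hf : Measurable[m] f) :
    Measurable[m.comap (Prod.fst : Ω' × ℝ → Ω')] fun ω ↦ f ω.1 := by
  intro s hs
  exact ⟨f ⁻¹' s, hf hs, rfl⟩

/-- Events of the pulled-back σ-algebra are pull-backs of events. [folklore] -/
theorem exists_preimage_fst_of_measurableSet_comap {m : MeasurableSpace Ω'} {A : Set (Ω' × ℝ)}
    (hA : MeasurableSet[m.comap (Prod.fst : Ω' × ℝ → Ω')] A) :
    ∃ A₀ : Set Ω', MeasurableSet[m] A₀ ∧ A = Prod.fst ⁻¹' A₀ := by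
  obtain ⟨A₀, hA₀, rfl⟩ := hA
  exact ⟨A₀, hA₀, rfl⟩

end Comap

section Pullback

variable {Ω' : Type*} [MeasurableSpace Ω'] {Q : Measure Ω'}

/-- The first marginal of `Q ⊗ unif` is `Q`. [folklore] -/
theorem map_fst_prod_unif : (Q.prod unif).map Prod.fst = Q := by
  rw [Measure.map_fst_prod, measure_univ, one_smul]

/-- Almost sure statements pull back along the first projection. [folklore] -/
theorem ae_prod_unif_of_ae {p : Ω' → Prop} (h : ∀ᵐ ω ∂Q, p ω) : ∀ᵐ ω ∂Q.prod unif, p ω.1 := by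
  have h' : ∀ᵐ ω ∂(Q.prod unif).map Prod.fst, p ω := by rwa [map_fst_prod_unif]
  exact ae_of_ae_map measurable_fst.aemeasurable h'

/-- Integrals of functions of the first coordinate. [folklore] -/
theorem integral_prod_unif_comp_fst {F : Ω' → ℝ} (hF : AEStronglyMeasurable F Q) :
    ∫ ω, F ω.1 ∂Q.prod unif = ∫ ω, F ω ∂Q := by
  rw [← integral_map measurable_fst.aemeasurable (by rwa [map_fst_prod_unif]), map_fst_prod_unif]

/-- Integrability of functions of the first coordinate. [folklore] -/
theorem integrable_prod_unif_comp_fst {F : Ω' → ℝ} (hF : Integrable F Q) :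
    Integrable (fun ω : Ω' × ℝ ↦ F ω.1) (Q.prod unif) := by
  have := (integrable_map_measure (μ := Q.prod unif) (f := Prod.fst) (g := F)
    (by rw [map_fst_prod_unif]; exact hF.aestronglyMeasurable) measurable_fst.aemeasurable).1
    (by rw [map_fst_prod_unif]; exact hF)
  exact this

/-- Set integrals over pulled-back events. [folklore] -/
theorem setIntegral_prod_unif_preimage_fst {F : Ω' → ℝ} (hF : Integrable F Q) {A : Set Ω'}
    (hA : MeasurableSet A) :
    ∫ ω in Prod.fst ⁻¹' A, F ω.1 ∂Q.prod unif = ∫ ω in A, F ω ∂Q := by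
  rw [← integral_indicator (measurable_fst hA), ← integral_indicator hA]
  have : (fun ω : Ω' × ℝ ↦ (Prod.fst ⁻¹' A).indicator (fun ω ↦ F ω.1) ω) =
      fun ω ↦ (A.indicator F) ω.1 := by
    funext ω
    by_cases h : ω.1 ∈ A
    · rw [indicator_of_mem (show ω ∈ Prod.fst ⁻¹' A from h), indicator_of_mem h]
    · rw [indicator_of_notMem (show ω ∉ Prod.fst ⁻¹' A from h), indicator_of_notMem h]
  rw [this]
  exact integral_prod_unif_comp_fst (hF.indicator hA).aestronglyMeasurable

/-- Measures of pulled-back events. [folklore] -/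
theorem prod_unif_preimage_fst {A : Set Ω'} (hA : MeasurableSet A) :
    (Q.prod unif) (Prod.fst ⁻¹' A) = Q A := by
  rw [← Measure.map_apply measurable_fst hA, map_fst_prod_unif]

end Pullback

/-! ### The stage invariant -/

/-- The constant `C₄ = 2/(1-θ₀)²` of the second-moment bound of the exit time
(`BrownianExitIntervalTail`). [folklore] -/
def C4 : ℝ := 2 / (1 - (gaussianReal 0 1).real (Ioo (-1) 1)) ^ 2

section Stage

variable [MeasurableSpace C(ℝ≥0, ℝ)] [BorelSpace C(ℝ≥0, ℝ)]
variable {Ω Λ : Type} [Fintype Ω] [MeasurableSpace Ω] [DecidableEq Λ] [MeasurableSpace Λ]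

/-- **The stage invariant of the Skorokhod embedding** after `n` steps (Durrett (2019), proof of
Thm. 8.2.1, induction hypothesis; Lawler–Schramm–Werner (2004), Lemma 3.8): a probability space
`(Ω', Q)` carrying the Brownian path `W` (law: the Wiener law on `C([0,∞), ℝ)`), the chain of
labels `lam k` (standing for the histories `H k`), the embedding times `τ k` and a filtration
`G` (constant from `n` on), such that: `G n` is generated by the bookkeeping variable `hist`; the
labels have the laws of the histories (`law`) and form a chain (`chain`); `W(τ k)` is the
value of the martingale on the current atom (`val`); on `[τ k, τ (k+1)]` the path stays within
`2δ` of `W(τ k)` (`osc`); the increments `τ (k+1) - τ k - (W(τ (k+1)) - W(τ k))²` integrate to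
zero on every event of `G k` (`mds`) and `E[(τ (k+1) - τ k)²; A] ≤ C₄ (4δ)⁴ Q(A)` (`sqb`); given
`G k` the next label has the conditional law `pc k (lam k) ·` of the martingale (`trans`); and the
path after `τ n`, re-based, is a Brownian path independent of `hist` (`indep`, `zlaw`) — the
strong Markov property that drives the next step. [cite: Durrett2019, Thm. 8.2.1] -/
structure Stage (D : MartingaleData Ω Λ) (n : ℕ) where
  /-- the sample space after `n` steps -/
  Ω' : Type
  /-- its σ-algebra -/
  mΩ' : MeasurableSpace Ω'
  /-- the probability law -/
  Q : Measure Ω'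
  /-- the type of the bookkeeping variable generating `G n` -/
  Hist : Type
  /-- its σ-algebra -/
  mHist : MeasurableSpace Hist
  /-- the bookkeeping variable after `n` steps -/
  hist : Ω' → Hist
  /-- the Brownian path -/
  W : Ω' → C(ℝ≥0, ℝ)
  /-- the label chain (`lam k` for `k ≤ n`, constant afterwards) -/
  lam : ℕ → Ω' → Λ
  /-- the embedding times (`τ k` for `k ≤ n`, constant afterwards) -/
  τ : ℕ → Ω' → ℝ≥0
  /-- the filtration (`G k` for `k ≤ n`, constant afterwards) -/
  G : ℕ → MeasurableSpace Ω'
  prob : IsProbabilityMeasure Q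
  hhist : Measurable hist
  hGn : G n = mHist.comap hist
  hG_le : ∀ k, G k ≤ mΩ'
  hG_mono : ∀ k, G k ≤ G (k + 1)
  hW : Measurable W
  hWlaw : Q.map W = wienerLawC
  hW0 : ∀ ω, W ω 0 = 0
  hτ : ∀ k, Measurable[G k] (τ k)
  hτ0 : ∀ ω, τ 0 ω = 0
  hτ_mono : ∀ k ω, τ k ω ≤ τ (k + 1) ω
  hτ_const : ∀ k, n ≤ k → τ k = τ n
  hlam : ∀ k, Measurable[G k] (lam k)
  hlam_const : ∀ k, n ≤ k → lam k = lam n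
  hlam_mem : ∀ k ω, lam k ω ∈ D.labelSet k
  law : ∀ k ≤ n, ∀ l, Q.real {ω | lam k ω = l} = D.pH k l
  chain : ∀ k < n, ∀ᵐ ω ∂Q, lam (k + 1) ω ∈ D.children k (lam k ω)
  val : ∀ k ≤ n, ∀ᵐ ω ∂Q, W ω (τ k ω) = D.Mval k (lam k ω)
  osc : ∀ k < n, ∀ᵐ ω ∂Q, ∀ t : ℝ≥0, τ k ω ≤ t → t ≤ τ (k + 1) ω →
    |W ω t - W ω (τ k ω)| ≤ 2 * D.δ
  int1 : ∀ k < n, Integrable (fun ω ↦ ((τ (k + 1) ω : ℝ) - τ k ω)) Q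
  int2 : ∀ k < n, Integrable (fun ω ↦ ((τ (k + 1) ω : ℝ) - τ k ω) ^ 2) Q
  intW : ∀ k < n, Integrable (fun ω ↦ (W ω (τ (k + 1) ω) - W ω (τ k ω)) ^ 2) Q
  mds : ∀ k < n, ∀ A, MeasurableSet[G k] A →
    ∫ ω in A, (((τ (k + 1) ω : ℝ) - τ k ω) - (W ω (τ (k + 1) ω) - W ω (τ k ω)) ^ 2) ∂Q = 0
  sqb : ∀ k < n, ∀ A, MeasurableSet[G k] A →
    ∫ ω in A, ((τ (k + 1) ω : ℝ) - τ k ω) ^ 2 ∂Q ≤ C4 * (4 * D.δ) ^ 4 * Q.real A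
  trans : ∀ k < n, ∀ A, MeasurableSet[G k] A → ∀ c : Λ,
    Q.real (A ∩ {ω | lam (k + 1) ω = c}) =
      ∫ ω in A, (if c ∈ D.children k (lam k ω) then D.pc k (lam k ω) c else 0) ∂Q
  indep : IndepFun (fun ω ↦ shiftPath (τ n ω) (W ω)) hist Q
  zlaw : Q.map (fun ω ↦ shiftPath (τ n ω) (W ω)) = wienerLawC

end Stage

/-! ### The initial stage -/

section Zero

/-- The re-based Brownian path is the Brownian path (`B₀ = 0`): `shiftPath 0 p = p` when
`p 0 = 0`. [folklore] -/
theorem shiftPath_zero_of_apply_zero {p : C(ℝ≥0, ℝ)} (hp : p 0 = 0) : shiftPath 0 p = p := by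
  ext u
  rw [shiftPath_apply, zero_add, hp, sub_zero]

/-- The total mass of the level-`0` labels: `∑_{l ∈ image (H 0)} P[H 0 = l] = 1`. [folklore] -/
theorem sum_pH_zero_image {Ω Λ : Type*} [Fintype Ω] [MeasurableSpace Ω] [MeasurableSingletonClass Ω]
    [DecidableEq Λ] {D : MartingaleData Ω Λ} (hD : D.IsValid) :
    ∑ l ∈ Finset.univ.image (D.H 0), D.pH 0 l = 1 := by
  haveI := hD.prob
  have h := Finset.sum_fiberwise_of_maps_to (s := (Finset.univ : Finset Ω))
    (t := Finset.univ.image (D.H 0)) (g := D.H 0) (fun ω _ ↦ Finset.mem_image_of_mem _ (Finset.mem_univ ω))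
    (fun ω ↦ D.P.real {ω})
  have h' : ∀ l, ∑ ω ∈ Finset.univ.filter (fun ω ↦ D.H 0 ω = l), D.P.real {ω} = D.pH 0 l :=
    fun l ↦ rfl
  simp only [h'] at h
  rw [h, sum_measureReal_singleton, Finset.coe_univ, probReal_univ]

variable [MeasurableSpace C(ℝ≥0, ℝ)] [BorelSpace C(ℝ≥0, ℝ)]
variable {Ω Λ : Type} [Fintype Ω] [MeasurableSpace Ω] [MeasurableSingletonClass Ω] [Nonempty Ω]
  [DecidableEq Λ] [Countable Λ] [MeasurableSpace Λ] [MeasurableSingletonClass Λ]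
  {D : MartingaleData Ω Λ}

/-- **The initial stage**: the pre-Wiener space times a uniform randomiser, the Brownian path,
the initial label sampled from the law of `H 0`, `τ 0 = 0`, `G 0 = σ(randomiser)`.
Durrett (2019), proof of Thm. 8.2.1 (start of the induction). [cite: Durrett2019, Thm. 8.2.1] -/
def stageZero (hD : D.IsValid) : Stage D 0 where
  Ω' := (ℝ≥0 → ℝ) × ℝ
  mΩ' := inferInstance
  Q := Process.preWienerMeasure.prod unif
  Hist := ℝ
  mHist := inferInstance
  hist := Prod.snd
  W := fun ω ↦ brownianPathC ω.1
  lam := fun _ ω ↦ wselect (Finset.univ.image (D.H 0)) (D.pH 0) D.defaultLabel ω.2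
  τ := fun _ _ ↦ 0
  G := fun _ ↦ MeasurableSpace.comap (Prod.snd : (ℝ≥0 → ℝ) × ℝ → ℝ) inferInstance
  prob := by
    haveI := isProbabilityMeasure_preWienerMeasure'
    infer_instance
  hhist := measurable_snd
  hGn := rfl
  hG_le := fun _ ↦ measurable_snd.comap_le
  hG_mono := fun _ ↦ le_rfl
  hW := measurable_brownianPathC.comp measurable_fst
  hWlaw := by
    haveI := isProbabilityMeasure_preWienerMeasure'
    change Measure.map (brownianPathC ∘ Prod.fst) _ = _
    rw [← Measure.map_map measurable_brownianPathC measurable_fst, Measure.map_fst_prod,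
      measure_univ, one_smul]
    rfl
  hW0 := fun ω ↦ brownianPathC_apply_zero ω.1
  hτ := fun _ ↦ measurable_const
  hτ0 := fun _ ↦ rfl
  hτ_mono := fun _ _ ↦ le_rfl
  hτ_const := fun _ _ ↦ rfl
  hlam := fun _ ↦ by
    intro s hs
    exact ⟨wselect (Finset.univ.image (D.H 0)) (D.pH 0) D.defaultLabel ⁻¹' s,
      measurable_wselect _ _ _ hs, rfl⟩
  hlam_const := fun _ _ ↦ rfl
  hlam_mem := by
    intro k ω
    refine D.labelSet_mono (Nat.zero_le k) ?_
    have hsub : Finset.univ.image (D.H 0) ⊆ D.labelSet 0 := fun l hl ↦ by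
      obtain ⟨ω₀, -, rfl⟩ := Finset.mem_image.1 hl
      exact D.H_mem_labelSet le_rfl ω₀
    by_cases hne : (Finset.univ.image (D.H 0)).Nonempty
    · exact hsub (wselect_mem hne _ _ _)
    · rw [wselect, dif_neg hne]
      exact D.H_mem_labelSet le_rfl _
  law := by
    haveI := isProbabilityMeasure_preWienerMeasure'
    intro k hk l
    have hk0 : k = 0 := Nat.le_zero.1 hk
    subst hk0
    set S : Set ℝ := {u | wselect (Finset.univ.image (D.H 0)) (D.pH 0) D.defaultLabel u = l} with hS
    have hSm : MeasurableSet S := measurable_wselect _ _ _ (measurableSet_singleton l)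
    have hset : {ω : (ℝ≥0 → ℝ) × ℝ |
        wselect (Finset.univ.image (D.H 0)) (D.pH 0) D.defaultLabel ω.2 = l} = Prod.snd ⁻¹' S := rfl
    have hmap : (Process.preWienerMeasure.prod unif) (Prod.snd ⁻¹' S) = unif S := by
      rw [← Measure.map_apply measurable_snd hSm, Measure.map_snd_prod, measure_univ, one_smul]
    rw [measureReal_def, hset, hmap]
    by_cases hl : l ∈ Finset.univ.image (D.H 0)
    · rw [hS, unif_wselect_eq (fun l _ ↦ MartingaleData.pH_nonneg 0 l) (sum_pH_zero_image hD) _ hl,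
        ENNReal.toReal_ofReal (MartingaleData.pH_nonneg 0 l)]
    · rw [hS, unif_wselect_eq_zero (fun l _ ↦ MartingaleData.pH_nonneg 0 l) (sum_pH_zero_image hD) _ hl,
        ENNReal.toReal_zero]
      -- a label outside the image of `H 0` has an empty atom
      rw [MartingaleData.pH, Finset.sum_eq_zero]
      intro ω hω
      exact absurd (Finset.mem_image_of_mem (D.H 0) (Finset.mem_univ ω))
        (by rwa [(D.mem_atom).1 hω])
  chain := fun k hk ↦ absurd hk (Nat.not_lt_zero k)
  val := by
    intro k hk
    obtain rfl := Nat.le_zero.1 hk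
    refine ae_of_all _ fun ω ↦ ?_
    rw [brownianPathC_apply_zero]
    -- `Mval 0 l = 0` since `M 0 = 0`
    rw [MartingaleData.Mval, Finset.sum_eq_zero (fun ω' _ ↦ by rw [hD.zero ω', mul_zero]), zero_div]
  osc := fun k hk ↦ absurd hk (Nat.not_lt_zero k)
  int1 := fun k hk ↦ absurd hk (Nat.not_lt_zero k)
  int2 := fun k hk ↦ absurd hk (Nat.not_lt_zero k)
  intW := fun k hk ↦ absurd hk (Nat.not_lt_zero k)
  mds := fun k hk ↦ absurd hk (Nat.not_lt_zero k)
  sqb := fun k hk ↦ absurd hk (Nat.not_lt_zero k)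
  trans := fun k hk ↦ absurd hk (Nat.not_lt_zero k)
  indep := by
    haveI := isProbabilityMeasure_preWienerMeasure'
    have h := indepFun_prod (μ := Process.preWienerMeasure) (ν := unif) (X := brownianPathC)
      (Y := (id : ℝ → ℝ)) measurable_brownianPathC measurable_id
    refine h.congr (ae_of_all _ fun ω ↦ ?_) EventuallyEq.rfl
    exact (shiftPath_zero_of_apply_zero (brownianPathC_apply_zero ω.1)).symm
  zlaw := by
    haveI := isProbabilityMeasure_preWienerMeasure'
    have hae : (fun ω : (ℝ≥0 → ℝ) × ℝ ↦ shiftPath 0 (brownianPathC ω.1)) =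
        fun ω ↦ brownianPathC ω.1 := by
      funext ω
      exact shiftPath_zero_of_apply_zero (brownianPathC_apply_zero ω.1)
    rw [hae]
    change Measure.map (brownianPathC ∘ Prod.fst) _ = _
    rw [← Measure.map_map measurable_brownianPathC measurable_fst, Measure.map_fst_prod,
      measure_univ, one_smul]
    rfl

end Zero

end Literature.Probability.RandomPlanarGeometry.SkorokhodEmbedding
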